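import Summits.AtomisticToContinuum.HydrodynamicLimit.Theorems.MourreKoopmanChargesStressStrongMixingStressFramework
import Literature.Barriers.AtomisticToContinuum.HardDiskTranslationInvarianceSteps
import HarnessLib

/-!
# `StressStrongMixing` · line `birth`, stub Fcov `stub_equilibriumFlowShiftCovariant`, part 1:
# spatial translations map Gibbs states of the hard-sphere gas to Gibbs states

Support file for the crux item stmt-AtomisticToContinuum-9584 (`StressStrongMixing`, route
`MourreKoopmanCharges` of `AtomisticToContinuum/HydrodynamicLimit`), serving the registered stub
`stub_equilibriumFlowShiftCovariant` (Fcov) of the skeleton `Cruxes/StressStrongMixing/Lines/birth.lean`: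

  `∀ σ > 0, ∀ Φ : InfiniteHardSphereFlow (Fin 3) σ, Φ.IsEquilibriumFlow → ∀ z β > 0, ∀ μ,`
  `IsHardSphereGibbs σ z β 0 μ → ∀ t x, Φ.flow t ∘ spatialShift x =ᵐ[μ] spatialShift x ∘ Φ.flow t`.

The route to the stub: conjugate the flow by a spatial translation, show that the conjugate is again an
equilibrium flow, and compare the two by Alexander's uniqueness theorem (`InfiniteHardSphereFlow.unique`,
Alexander 1976 Cor. 5.4, a named fact).  The second step needs that the class of Gibbs states of the
hard-sphere gas is stable under spatial translations, which is what this file proves, in every dimension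
`d`, for every drift `u`, and for every phase-space translation `v = (a, 0)` (zero velocity component,
`v.2 = 0`):

* `hardCoreIn_translate_iff`, `superposeIn_translate`, `map_add_maxwellPhaseMeasure`,
  `pi_maxwellPhaseMeasure_eq_map`, `gibbsWeight_translate`, `gibbsSpec_translate` — **translation
  covariance of the finite-volume specification**, `γ_Λ(A | Y + v) = γ_{Λ-a}(A - v | Y)`: Lebesgue
  measure is translation invariant, the Maxwellian factor only sees velocities, the hard core only sees
  position differences (Georgii, *Gibbs Measures and Phase Transitions*, (5.8)–(5.10): "`γ` is
  `τ̂`-invariant"; the phase-space version of the planar hard-disc computation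
  `Literature.Barriers.AtomisticToContinuum.HardDisk.weight_translate` / `gibbsKernel_translate` /
  `IsGibbs.map_translate` (Richthammer 2007 §4.3), from which the proofs are adapted);
* `isHardSphereGibbs_map_translate` — hence the image `μ ∘ τ_v⁻¹` of a Gibbs state under
  `τ_v = PointConfig.translate v` is a Gibbs state with the same parameters (the DLR equation of the
  image in the window `Λ` is the DLR equation of `μ` in `Λ - a`);
* `isHardSphereGibbs_map_spatialShift` — the same in the vocabulary of `FluctuationSpace.lean` (`d = 3`,
  `spatialShift x = τ_{(x,0)}`), the registered helper of this file.

Also recorded: two consequences of the group law of `PointConfig.translate` (the tree's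
`PointConfig.translate_translate` / `translate_zero_eq_id` of `HardDiskTranslationInvarianceSteps.lean`):
`pointConfig_translate_neg_translate`, `pointConfig_translate_translate_neg`, used here and in part 2
(`…StressStrongMixingEquilibriumFlowShiftCovariant.lean`: the conjugate flow and the conditional stub).

References: R. Alexander, Comm. Math. Phys. 49 (1976) 217–232, §2.1; H.-O. Georgii, *Gibbs Measures and
Phase Transitions* (1988/2011), (5.8)–(5.10) and Prop. 9.1; T. Richthammer, Comm. Math. Phys. 274 (2007),
§4.3.
-/

noncomputable section

open MeasureTheory ProbabilityTheory Filter Topology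
open scoped InnerProductSpace ENNReal

namespace Summit.AtomisticToContinuum.HydrodynamicLimit.Theorems.MourreKoopmanChargesStressStrongMixing

open Literature.MathematicalPhysics.KineticTheory Literature.Analysis.FluidPDE
open Literature.Analysis.FunctionSpaces (PointConfig)

/-! ### Two consequences of the group law of translations of point configurations -/

section PointConfigTranslate

variable {E : Type*} [TopologicalSpace E] [AddGroup E] [ContinuousAdd E]

/-- `(c + v) - v = c` (from the tree's `PointConfig.translate_translate`, `translate_zero_eq_id`).
[folklore] -/
theorem pointConfig_translate_neg_translate (v : E) (c : PointConfig E) :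
    (c.translate v).translate (-v) = c := by
  rw [PointConfig.translate_translate, add_neg_cancel]
  exact congrFun PointConfig.translate_zero_eq_id c

/-- `(c - v) + v = c` (from the tree's `PointConfig.translate_translate`, `translate_zero_eq_id`).
[folklore] -/
theorem pointConfig_translate_translate_neg (v : E) (c : PointConfig E) :
    (c.translate (-v)).translate v = c := by
  rw [PointConfig.translate_translate, neg_add_cancel]
  exact congrFun PointConfig.translate_zero_eq_id c

end PointConfigTranslate

/-! ### Translation covariance of the hard-sphere specification -/

section Specification

variable {d : Type*} [Fintype d]

/-- **The windowed hard core is translation covariant**: `X + v` satisfies the hard-core constraint in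
the window `Λ` iff `X` satisfies it in `Λ - v.1` (any phase-space vector `v`: the constraint only sees
position differences). (Adapted from the planar `HardDisk.hardCoreIn_translate_iff`.) [folklore] -/
theorem hardCoreIn_translate_iff (ε : ℝ) (Λ : Set (EuclideanSpace ℝ d))
    (v : EuclideanSpace ℝ d × EuclideanSpace ℝ d)
    (X : PointConfig (EuclideanSpace ℝ d × EuclideanSpace ℝ d)) :
    HardCoreIn ε Λ (X.translate v) ↔ HardCoreIn ε ((· + v.1) ⁻¹' Λ) X := by
  constructor
  · intro h p hp q hq hpq hΛ
    have hp' : p + v ∈ (X.translate v).carrier := ⟨p, hp, rfl⟩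
    have hq' : q + v ∈ (X.translate v).carrier := ⟨q, hq, rfl⟩
    have key := h (p + v) hp' (q + v) hq' (fun heq => hpq (add_right_cancel heq))
      (by simpa only [Set.mem_preimage, Prod.fst_add] using hΛ)
    simpa only [Prod.fst_add, add_sub_add_right_eq_sub] using key
  · intro h p' hp' q' hq' hpq hΛ
    obtain ⟨p, hp, rfl⟩ := (show p' ∈ (X.translate v).carrier from hp')
    obtain ⟨q, hq, rfl⟩ := (show q' ∈ (X.translate v).carrier from hq')
    have hne : p ≠ q := fun h' => hpq (by rw [h'])
    have hΛ' : p.1 ∈ (· + v.1) ⁻¹' Λ ∨ q.1 ∈ (· + v.1) ⁻¹' Λ := by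
      simpa only [Set.mem_preimage, Prod.fst_add] using hΛ
    simpa only [Prod.fst_add, add_sub_add_right_eq_sub] using h p hp q hq hne hΛ'

/-- **Superposition is translation covariant**: `(x + v)_Λ (Y + v)_{Λᶜ} = (x_{Λ-v.1} Y_{(Λ-v.1)ᶜ}) + v`.
(Adapted from the planar `HardDisk.superpose_translate`.) [folklore] -/
theorem superposeIn_translate (Λ : Set (EuclideanSpace ℝ d)) {k : ℕ}
    (x : Fin k → EuclideanSpace ℝ d × EuclideanSpace ℝ d)
    (Y : PointConfig (EuclideanSpace ℝ d × EuclideanSpace ℝ d))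
    (v : EuclideanSpace ℝ d × EuclideanSpace ℝ d) :
    superposeIn Λ (fun i => x i + v) (Y.translate v) =
      (superposeIn ((· + v.1) ⁻¹' Λ) x Y).translate v := by
  apply PointConfig.ext
  intro p
  change (p ∈ Set.range (fun i => x i + v) ∩ Prod.fst ⁻¹' Λ ∪
      (fun y => y + v) '' Y.carrier ∩ Prod.fst ⁻¹' Λᶜ) ↔
    p ∈ (fun y => y + v) ''
      (Set.range x ∩ Prod.fst ⁻¹' ((· + v.1) ⁻¹' Λ) ∪ Y.carrier ∩ Prod.fst ⁻¹' ((· + v.1) ⁻¹' Λ)ᶜ)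
  constructor
  · rintro (⟨⟨i, rfl⟩, hΛ⟩ | ⟨⟨y, hy, rfl⟩, hΛ⟩)
    · exact ⟨x i, Or.inl ⟨⟨i, rfl⟩, hΛ⟩, rfl⟩
    · exact ⟨y, Or.inr ⟨hy, hΛ⟩, rfl⟩
  · rintro ⟨y, (⟨⟨i, rfl⟩, hΛ⟩ | ⟨hy, hΛ⟩), rfl⟩
    · exact Or.inl ⟨⟨i, rfl⟩, hΛ⟩
    · exact Or.inr ⟨⟨y, hy, rfl⟩, hΛ⟩

/-- The one-particle a priori measure `Leb|_Λ ⊗ M_β(w-u)dw` is σ-finite. [folklore] -/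
theorem sigmaFinite_maxwellPhaseMeasure (β : ℝ) (u : EuclideanSpace ℝ d)
    (Λ : Set (EuclideanSpace ℝ d)) : SigmaFinite (maxwellPhaseMeasure β u Λ) := by
  unfold maxwellPhaseMeasure
  infer_instance

/-- **The one-particle a priori measure is translation covariant**: for `v = (a, 0)` the image of
`Leb|_{Λ-a} ⊗ M_β(w-u)dw` under `p ↦ p + v` is `Leb|_Λ ⊗ M_β(w-u)dw` (translation invariance of Lebesgue
measure; the Maxwellian factor is untouched since `v.2 = 0`). [folklore] -/
theorem map_add_maxwellPhaseMeasure (β : ℝ) (u : EuclideanSpace ℝ d) (Λ : Set (EuclideanSpace ℝ d))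
    {v : EuclideanSpace ℝ d × EuclideanSpace ℝ d} (hv : v.2 = 0) :
    (maxwellPhaseMeasure β u ((· + v.1) ⁻¹' Λ)).map (· + v) = maxwellPhaseMeasure β u Λ := by
  have h1 : (fun p : EuclideanSpace ℝ d × EuclideanSpace ℝ d => p + v) = Prod.map (· + v.1) id := by
    funext p
    refine Prod.ext rfl ?_
    show p.2 + v.2 = p.2
    rw [hv, add_zero]
  have h2 : ((volume : Measure (EuclideanSpace ℝ d)).restrict ((· + v.1) ⁻¹' Λ)).map (· + v.1) =
      (volume : Measure (EuclideanSpace ℝ d)).restrict Λ := by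
    have h := (MeasurableEquiv.addRight v.1).measurableEmbedding.restrict_map
      (volume : Measure (EuclideanSpace ℝ d)) Λ
    rw [MeasurableEquiv.coe_addRight, map_add_right_eq_self] at h
    exact h.symm
  unfold maxwellPhaseMeasure
  rw [h1, ← Measure.map_prod_map _ _ (measurable_add_const v.1) measurable_id, Measure.map_id, h2]

/-- The `k`-particle a priori measure on `Λ` is the image of the one on `Λ - a` under the diagonal
shift `x ↦ x + (v, …, v)`, `v = (a, 0)`. [folklore] -/
theorem pi_maxwellPhaseMeasure_eq_map (β : ℝ) (u : EuclideanSpace ℝ d) (Λ : Set (EuclideanSpace ℝ d))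
    {v : EuclideanSpace ℝ d × EuclideanSpace ℝ d} (hv : v.2 = 0) (k : ℕ) :
    (Measure.pi fun _ : Fin k => maxwellPhaseMeasure β u Λ) =
      (Measure.pi fun _ : Fin k => maxwellPhaseMeasure β u ((· + v.1) ⁻¹' Λ)).map
        (MeasurableEquiv.addRight fun _ : Fin k => v) := by
  have hpi := Measure.pi_map_pi (μ := fun _ : Fin k => maxwellPhaseMeasure β u ((· + v.1) ⁻¹' Λ))
    (f := fun (_ : Fin k) (p : EuclideanSpace ℝ d × EuclideanSpace ℝ d) => p + v)
    (hμ := fun _ => by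
      rw [map_add_maxwellPhaseMeasure β u Λ hv]
      exact sigmaFinite_maxwellPhaseMeasure β u Λ)
    (fun _ => (measurable_add_const _).aemeasurable)
  simp only [map_add_maxwellPhaseMeasure β u Λ hv] at hpi
  rw [MeasurableEquiv.coe_addRight,
    show (fun x : Fin k → EuclideanSpace ℝ d × EuclideanSpace ℝ d => x + fun _ => v) =
      fun x i => x i + v from rfl, hpi]

/-- **The finite-volume weights are translation covariant**:
`gibbsWeight Λ (Y + v) A = gibbsWeight (Λ - a) Y (A - v)` for `v = (a, 0)` (change of variables
`x ↦ x + (v, …, v)` in each `k`-particle integral). (Adapted from the planar `HardDisk.weight_translate`.)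
[folklore] -/
theorem gibbsWeight_translate (ε z β : ℝ) (u : EuclideanSpace ℝ d) (Λ : Set (EuclideanSpace ℝ d))
    (Y : PointConfig (EuclideanSpace ℝ d × EuclideanSpace ℝ d))
    (A : Set (PointConfig (EuclideanSpace ℝ d × EuclideanSpace ℝ d)))
    {v : EuclideanSpace ℝ d × EuclideanSpace ℝ d} (hv : v.2 = 0) :
    gibbsWeight ε z β u Λ (Y.translate v) A =
      gibbsWeight ε z β u ((· + v.1) ⁻¹' Λ) Y (PointConfig.translate v ⁻¹' A) := by
  unfold gibbsWeight
  refine tsum_congr fun k => ?_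
  congr 1
  rw [pi_maxwellPhaseMeasure_eq_map β u Λ hv k, lintegral_map_equiv]
  refine lintegral_congr fun x => ?_
  have hx : superposeIn Λ ((MeasurableEquiv.addRight fun _ : Fin k => v) x) (Y.translate v) =
      (superposeIn ((· + v.1) ⁻¹' Λ) x Y).translate v := by
    rw [MeasurableEquiv.coe_addRight]
    exact superposeIn_translate Λ x Y v
  rw [hx]
  by_cases hmem : (superposeIn ((· + v.1) ⁻¹' Λ) x Y).translate v ∈ A ∩ {X | HardCoreIn ε Λ X}
  · have hmem' : superposeIn ((· + v.1) ⁻¹' Λ) x Y ∈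
        PointConfig.translate v ⁻¹' A ∩ {X | HardCoreIn ε ((· + v.1) ⁻¹' Λ) X} :=
      ⟨hmem.1, (hardCoreIn_translate_iff ε Λ v _).1 hmem.2⟩
    rw [Set.indicator_of_mem hmem, Set.indicator_of_mem hmem']
    rfl
  · have hmem' : superposeIn ((· + v.1) ⁻¹' Λ) x Y ∉
        PointConfig.translate v ⁻¹' A ∩ {X | HardCoreIn ε ((· + v.1) ⁻¹' Λ) X} :=
      fun h' => hmem ⟨h'.1, (hardCoreIn_translate_iff ε Λ v _).2 h'.2⟩
    rw [Set.indicator_of_notMem hmem, Set.indicator_of_notMem hmem']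

/-- **The hard-sphere specification is translation covariant**:
`γ_Λ(A | Y + v) = γ_{Λ-a}(A - v | Y)` for `v = (a, 0)` (Georgii's "`γ` is `τ̂`-invariant"). [folklore] -/
theorem gibbsSpec_translate (ε z β : ℝ) (u : EuclideanSpace ℝ d) (Λ : Set (EuclideanSpace ℝ d))
    (Y : PointConfig (EuclideanSpace ℝ d × EuclideanSpace ℝ d))
    (A : Set (PointConfig (EuclideanSpace ℝ d × EuclideanSpace ℝ d)))
    {v : EuclideanSpace ℝ d × EuclideanSpace ℝ d} (hv : v.2 = 0) :
    gibbsSpec ε z β u Λ (Y.translate v) A =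
      gibbsSpec ε z β u ((· + v.1) ⁻¹' Λ) Y (PointConfig.translate v ⁻¹' A) := by
  rw [gibbsSpec, gibbsSpec, gibbsWeight_translate ε z β u Λ Y A hv,
    gibbsWeight_translate ε z β u Λ Y _ hv, Set.preimage_univ]

/-- Translates of bounded windows are bounded. [folklore] -/
theorem isBounded_preimage_add_const {Λ : Set (EuclideanSpace ℝ d)} (hb : Bornology.IsBounded Λ)
    (a : EuclideanSpace ℝ d) : Bornology.IsBounded ((· + a) ⁻¹' Λ) := by
  obtain ⟨R, hR⟩ := (Metric.isBounded_iff_subset_closedBall (0 : EuclideanSpace ℝ d)).1 hb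
  refine (Metric.isBounded_iff_subset_closedBall (-a)).2 ⟨R, fun x hx => ?_⟩
  have h := hR hx
  rw [Metric.mem_closedBall, dist_zero_right] at h
  rw [Metric.mem_closedBall, dist_eq_norm, sub_neg_eq_add]
  exact h

/-- **Spatial translations map Gibbs states to Gibbs states**: if `μ` is a Gibbs state of the
hard-sphere gas (diameter `ε`, activity `z`, inverse temperature `β`, drift `u`), so is its image
`μ ∘ τ_v⁻¹` under `τ_v = PointConfig.translate v` for every `v = (a, 0)` (the DLR equation in `Λ` for the
image is the DLR equation in `Λ - a` for `μ`, by `gibbsSpec_translate`). (Adapted from the planar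
`HardDisk.IsGibbs.map_translate`; Georgii, *Gibbs Measures and Phase Transitions*, (5.8)–(5.10).)
[folklore] -/
theorem isHardSphereGibbs_map_translate {ε z β : ℝ} {u : EuclideanSpace ℝ d}
    {μ : Measure (PointConfig (EuclideanSpace ℝ d × EuclideanSpace ℝ d))}
    (hμ : IsHardSphereGibbs ε z β u μ) {v : EuclideanSpace ℝ d × EuclideanSpace ℝ d} (hv : v.2 = 0) :
    IsHardSphereGibbs ε z β u (μ.map (PointConfig.translate v)) := by
  haveI := hμ.1
  refine ⟨Measure.isProbabilityMeasure_map (PointConfig.measurable_translate _).aemeasurable,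
    fun Λ hΛ hb A hA => ?_⟩
  -- `τ_v` as a measurable automorphism, for the change of variables in `∫ ⋯ d(μ ∘ τ_v⁻¹)`
  let e : PointConfig (EuclideanSpace ℝ d × EuclideanSpace ℝ d) ≃ᵐ
      PointConfig (EuclideanSpace ℝ d × EuclideanSpace ℝ d) :=
    { toFun := PointConfig.translate v
      invFun := PointConfig.translate (-v)
      left_inv := fun c => pointConfig_translate_neg_translate v c
      right_inv := fun c => pointConfig_translate_translate_neg v c
      measurable_toFun := PointConfig.measurable_translate _
      measurable_invFun := PointConfig.measurable_translate _ }
  rw [Measure.map_apply (PointConfig.measurable_translate _) hA,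
    hμ.2 _ ((measurable_add_const v.1) hΛ) (isBounded_preimage_add_const hb v.1) _
      (hA.preimage (PointConfig.measurable_translate _)),
    show (PointConfig.translate v : PointConfig (EuclideanSpace ℝ d × EuclideanSpace ℝ d) →
      PointConfig (EuclideanSpace ℝ d × EuclideanSpace ℝ d)) = ⇑e from rfl,
    lintegral_map_equiv]
  refine lintegral_congr fun Y => ?_
  exact (gibbsSpec_translate ε z β u Λ Y A hv).symm

end Specification

/-! ### Dimension three: the spatial shifts of `FluctuationSpace.lean` -/

/-- **Spatial shifts map Gibbs states of the hard-sphere gas to Gibbs states** (`d = 3`, zero drift, in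
the vocabulary of the stub: `spatialShift x = PointConfig.translate (x, 0)` on
`MarkedConfig = PointConfig (ℝ³ × ℝ³)`): for every Gibbs state `μ` at diameter `σ`, activity `z`, inverse
temperature `β`, and every `x ∈ ℝ³`, the image law `μ ∘ (spatialShift x)⁻¹` is a Gibbs state with the
same parameters (`isHardSphereGibbs_map_translate`). [folklore] -/
theorem isHardSphereGibbs_map_spatialShift :
    ∀ (σ z β : ℝ) (μ : Measure MarkedConfig), IsHardSphereGibbs σ z β (0 : V3) μ →
      ∀ x : V3, IsHardSphereGibbs σ z β (0 : V3) (μ.map (spatialShift x)) :=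
  fun _ _ _ _ hμ x => isHardSphereGibbs_map_translate hμ (v := ((x, 0) : V3 × V3)) rfl

end Summit.AtomisticToContinuum.HydrodynamicLimit.Theorems.MourreKoopmanChargesStressStrongMixing

end
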